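import Mathlib
import HarnessLib
import Summits.Ventures.LatticeQCDFlow.Exactness.NCMCGeneralSpaceEstimatorCLT

/-!
# Asymptotic normality of the reported acceptance and the Bernoulli variance cap on a general state space

HONEST FRAMING: exact (Metropolis-corrected) sampling algorithms for lattice gauge theory;
figures of merit are autocorrelation/cost numbers at stated couplings and volumes; no
continuum-physics claim.

Venture `LatticeQCDFlow` (cell pub-lqcd), topic `Exactness`; FANOUT row 13 (`eng-snf`, GEN-13).
NEW WORK of the cell (elementary), not a published result; nothing is cited as a fact.  A short
companion of `NCMCGeneralSpaceAcceptanceHoeffding.lean` (GEN-12) and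
`NCMCGeneralSpaceAcceptanceChernoff.lean` (GEN-13): those give finite-`N` TAIL bounds for the
reported mean acceptance; this file records its ASYMPTOTIC LAW (GEN-12's CLT for sample means of
an i.i.d. run, `tendstoInDistribution_sqrt_mul_sampleMean_sub`, applied to the bounded observable
`min(1, e^{−(W−c)})`) together with the variance cap that makes the law usable without knowing the
work distribution: a `[0,1]`-valued observable has variance at most `a(1 − a) ≤ 1/4`, `a` its mean.

## Content

* `memLp_two_of_mem_Icc` (bookkeeping), **`variance_le_mean_mul_one_sub_mean`** — for measurable
  `g : E → [0,1]` on a probability law, `Var_μ[g] ≤ a(1 − a)` with `a = E_μ g` (`g² ≤ g`), and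
  `variance_le_quarter` (`≤ 1/4`).
* **`tendstoInDistribution_sqrt_mul_sampleMean_accept_sub`** — for any measurable work `W` on a
  probability law `μ` and level constant `c`: `√n (ᾱ_n − a(c)) →d N(0, Var_μ[min(1, e^{−(W−c)})])`,
  `ᾱ_n` the mean of the first `n` acceptance probabilities of an i.i.d. run.
* For a Crooks pair `(κF, κR, s, e, W)` from `ν₀` to `ν₁` (independent forward evolutions from
  prior equilibrium): **`CrooksPair.tendstoInDistribution_sampleMean_accept`** (the CLT around
  `a_F(c) = E_F[min(1, e^{−(W−c)})]`) and **`CrooksPair.variance_accept_le`**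
  (`Var_F[min(1, e^{−(W−c)})] ≤ a_F(c)(1 − a_F(c))`): the asymptotic standard error of a reported
  acceptance from `N` independent proposals is at most `√(a_F(1 − a_F)/N)`, whatever the protocol.

Scope / NOT CLAIMED: independent evolutions only; limits in distribution (finite-`N` statements are
the Hoeffding / Chernoff files); no value for any concrete protocol.
-/

namespace Summit.Ventures.LatticeQCDFlow.Exactness.GeneralNCMC

open MeasureTheory ProbabilityTheory Set Filter Finset
open scoped ENNReal NNReal Topology

variable {E : Type*} [MeasurableSpace E]

section IID

variable (μ : Measure E) [IsProbabilityMeasure μ]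
variable {Ω' : Type*} [MeasurableSpace Ω'] {P' : Measure Ω'} [IsProbabilityMeasure P']

/-! ## The Bernoulli variance cap for a `[0,1]`-valued observable -/

/-- A `[0,1]`-valued measurable observable is in `L²` of a probability law. -/
theorem memLp_two_of_mem_Icc {g : E → ℝ} (hg : Measurable g) (h01 : ∀ a, g a ∈ Icc (0 : ℝ) 1) :
    MemLp g 2 μ :=
  MemLp.of_bound hg.aestronglyMeasurable 1 (Eventually.of_forall fun a => by
    rw [Real.norm_eq_abs, abs_of_nonneg (h01 a).1]
    exact (h01 a).2)

/-- **`Var_μ[g] ≤ a(1 − a)`** for a measurable `g : E → [0,1]` with mean `a` (`g² ≤ g` pointwise,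
so `E g² ≤ E g`). -/
theorem variance_le_mean_mul_one_sub_mean {g : E → ℝ} (hg : Measurable g)
    (h01 : ∀ a, g a ∈ Icc (0 : ℝ) 1) :
    Var[g; μ] ≤ (∫ a, g a ∂μ) * (1 - ∫ a, g a ∂μ) := by
  have hL2 := memLp_two_of_mem_Icc μ hg h01
  have hint : Integrable g μ := hL2.integrable one_le_two
  have hsq : ∫ a, g a ^ 2 ∂μ ≤ ∫ a, g a ∂μ :=
    integral_mono hL2.integrable_sq hint fun a => by
      have h := h01 a
      simp only [Set.mem_Icc] at h
      nlinarith [h.1, h.2]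
  have hv : Var[g; μ] = (∫ a, g a ^ 2 ∂μ) - (∫ a, g a ∂μ) ^ 2 := by
    rw [variance_eq_sub hL2]
    rfl
  rw [hv]
  nlinarith [hsq]

/-- … hence `Var_μ[g] ≤ 1/4`. -/
theorem variance_le_quarter {g : E → ℝ} (hg : Measurable g) (h01 : ∀ a, g a ∈ Icc (0 : ℝ) 1) :
    Var[g; μ] ≤ 1 / 4 := by
  refine (variance_le_mean_mul_one_sub_mean μ hg h01).trans ?_
  nlinarith [sq_nonneg ((∫ a, g a ∂μ) - 1 / 2)]

/-! ## The CLT for the mean acceptance of an i.i.d. run -/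

/-- The Metropolis acceptance probability `min(1, e^{−(W−c)})` is measurable and `[0,1]`-valued. -/
theorem measurable_accept_mem_Icc {W : E → ℝ} (hW : Measurable W) (c : ℝ) :
    Measurable (fun ε => min 1 (Real.exp (-(W ε - c)))) ∧
      ∀ ε, min 1 (Real.exp (-(W ε - c))) ∈ Icc (0 : ℝ) 1 :=
  ⟨measurable_const.min (Real.measurable_exp.comp (hW.sub measurable_const).neg),
    fun _ => ⟨le_min zero_le_one (Real.exp_pos _).le, min_le_left _ _⟩⟩

/-- **CLT for the mean acceptance**: for a measurable work `W` on a probability law `μ` and a level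
constant `c`, along an infinite i.i.d. run
`√n ((1/n) Σ_{i<n} min(1, e^{−(W(ω i)−c)}) − E_μ[min(1, e^{−(W−c)})]) →d N(0, Var_μ[min(1, e^{−(W−c)})])`. -/
theorem tendstoInDistribution_sqrt_mul_sampleMean_accept_sub {W : E → ℝ} (hW : Measurable W)
    (c : ℝ) {Y : Ω' → ℝ}
    (hY : HasLaw Y (gaussianReal 0 (Var[fun ε => min 1 (Real.exp (-(W ε - c))); μ]).toNNReal) P') :
    TendstoInDistribution
      (fun (n : ℕ) (ω : ℕ → E) => √(n : ℝ) *
        (sampleMean (fun ε => min 1 (Real.exp (-(W ε - c)))) (fun i : Fin n => ω i) -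
          ∫ ε, min 1 (Real.exp (-(W ε - c))) ∂μ))
      atTop Y (fun _ => Measure.infinitePi fun _ : ℕ => μ) P' :=
  tendstoInDistribution_sqrt_mul_sampleMean_sub μ (measurable_accept_mem_Icc hW c).1
    (memLp_two_of_mem_Icc μ (measurable_accept_mem_Icc hW c).1 (measurable_accept_mem_Icc hW c).2) hY

end IID

/-! ## For a Crooks pair -/

namespace CrooksPair

variable {Ω : Type*} [MeasurableSpace Ω]
variable {ν₀ ν₁ : Measure Ω} {κF κR : Kernel Ω E} {s e : E → Ω} {W : E → ℝ}
variable {Ω' : Type*} [MeasurableSpace Ω'] {P' : Measure Ω'} [IsProbabilityMeasure P']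

/-- **CLT for the reported acceptance of a Crooks pair**: along an infinite run of independent
forward evolutions from prior equilibrium, for every level constant `c`,
`√n (ᾱ_n − a_F(c)) →d N(0, Var_F[min(1, e^{−(W−c)})])`. -/
theorem tendstoInDistribution_sampleMean_accept [IsFiniteMeasure ν₀] [IsMarkovKernel κF]
    (h0 : ν₀ univ ≠ 0) (h : CrooksPair ν₀ ν₁ κF κR s e W) (c : ℝ) {Y : Ω' → ℝ}
    (hY : HasLaw Y (gaussianReal 0
      (Var[fun ε => min 1 (Real.exp (-(W ε - c))); fwdPathLaw ν₀ κF]).toNNReal) P') :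
    haveI := isProbabilityMeasure_fwdPathLaw ν₀ h0 κF
    TendstoInDistribution
      (fun (n : ℕ) (ω : ℕ → E) => √(n : ℝ) *
        (sampleMean (fun ε => min 1 (Real.exp (-(W ε - c)))) (fun i : Fin n => ω i) -
          ∫ ε, min 1 (Real.exp (-(W ε - c))) ∂(fwdPathLaw ν₀ κF)))
      atTop Y (fun _ => Measure.infinitePi fun _ : ℕ => fwdPathLaw ν₀ κF) P' := by
  haveI := isProbabilityMeasure_fwdPathLaw ν₀ h0 κF
  exact tendstoInDistribution_sqrt_mul_sampleMean_accept_sub (fwdPathLaw ν₀ κF) h.measurable_W c hY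

/-- **The asymptotic variance of the reported acceptance is at most `a_F(c)(1 − a_F(c))`** — the
Bernoulli cap, attained iff the acceptance probability is a.s. `0` or `1` (a deterministic
accept/reject pattern); in particular at most `1/4`. -/
theorem variance_accept_le [IsFiniteMeasure ν₀] [IsMarkovKernel κF] (h0 : ν₀ univ ≠ 0)
    (h : CrooksPair ν₀ ν₁ κF κR s e W) (c : ℝ) :
    Var[fun ε => min 1 (Real.exp (-(W ε - c))); fwdPathLaw ν₀ κF] ≤
      (∫ ε, min 1 (Real.exp (-(W ε - c))) ∂(fwdPathLaw ν₀ κF)) *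
        (1 - ∫ ε, min 1 (Real.exp (-(W ε - c))) ∂(fwdPathLaw ν₀ κF)) := by
  haveI := isProbabilityMeasure_fwdPathLaw ν₀ h0 κF
  exact variance_le_mean_mul_one_sub_mean (fwdPathLaw ν₀ κF) (measurable_accept_mem_Icc h.measurable_W c).1
    (measurable_accept_mem_Icc h.measurable_W c).2

/-- … and at most `1/4`. -/
theorem variance_accept_le_quarter [IsFiniteMeasure ν₀] [IsMarkovKernel κF] (h0 : ν₀ univ ≠ 0)
    (h : CrooksPair ν₀ ν₁ κF κR s e W) (c : ℝ) :
    Var[fun ε => min 1 (Real.exp (-(W ε - c))); fwdPathLaw ν₀ κF] ≤ 1 / 4 := by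
  haveI := isProbabilityMeasure_fwdPathLaw ν₀ h0 κF
  exact variance_le_quarter (fwdPathLaw ν₀ κF) (measurable_accept_mem_Icc h.measurable_W c).1
    (measurable_accept_mem_Icc h.measurable_W c).2

end CrooksPair

end Summit.Ventures.LatticeQCDFlow.Exactness.GeneralNCMC
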